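import Summits.QuantumFields.YangMills.Theorems.UnitScaleTiltAxialGaugeBondModulus
import Summits.QuantumFields.YangMills.Theorems.UnitScaleTiltProp7CombTowerCentral
import Literature.MathematicalPhysics.QuantumFieldTheory.Balaban1983to89.B10Eq68TorusRegularity
import HarnessLib

/-!
# `UnitScaleTiltAxialGaugeTorusTransfer` — THE TORUS TRANSFER OF THE AXIAL-GAUGE BOND MODULUS: the torus axial gauge `v₀ = axialT U y` of lit
# ✓`B10Eq27TorusAxialLog` IS the `ℤ^d` complete axial gauge of the periodic pull-back on the no-wrap ball, the `PlaqSmall` clause feeds the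
# plaquette size, the `SU(N) ↪ M_N(ℂ)ˣ` dictionary turns `dist1` of gauged plaquettes into norms of `plaqF` differences — and the (★) member row
# «η-scale ½-Hölder modulus of the axial-gauge representative» follows from ✓`dist1_axial_bond_translate_le` MODULO the curvature modulus in the
# axial gauge (R3′ FILE B, w5 g14, pair form) (route `UnitScaleTilt`, crux K1′ `MinimiserStabilityRegPr` stmt-QuantumFields-19200, (L3′b)-GRAD
# row (★); ★★OWNER RULING №35-B, ★p1 g25 CHAIR WORD №4 «R1 + the torus transfer → px19»)

Cell `ym3-torus` (YM ladder rung R3 = continuum SU(2) Yang–Mills on T³ — a RUNG, NOT the Clay problem: not d = 4, not infinite volume, not a mass gap);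
width seat `ym3-torus-px19` (gen 12); helper `--supports stmt-QuantumFields-19200`.  THEOREMS ONLY (0 `def`, 0 `sorry`, default heartbeats).

* §1 homomorphisms pass through the complete axial gauge on `ℤ^d` (`gaugeAct_axialFn_map`, over ✓`Prop7CombTowerCentral.hol_map`);
* §2 TORUS ↔ `ℤ^d`: on the ball `{|z_κ| ≤ R}` about `y` with NO WRAP-AROUND (`2(R + 1) ≤ sitesPerDir`), the torus axial gauge acts by the pulled-back
  `ℤ^d` axial gauge: `(U^{v₀})(y + z, μ) = (V♯_y)^{axialFn 0}(z, μ)` (★`gaugeAct_axialT_transl`, from lit ✓`holT_contourT_eq_gaugeActT`, ✓`hol_contour27`,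
  ✓`rel_transl_of_mem`); the `PlaqSmall` clause gives the pulled-back plaquettes (`dist1_hol_pull_plaqWord_le`);
* §3 `SU(N) ↪ M_N(ℂ)ˣ`: `dist1 (X·Y⁻¹) = ‖X − Y‖_op` for unitaries (`norm_mul_inv_sub_one_of_unitary`, `dist1_mul_inv_eq_norm_sub`), and the gauged
  plaquettes of the `M_N(ℂ)ˣ`-valued pull-back `(U♭)♯_y` (lit `unitsField ∘ toUField`, the carrier of ✓`CurvGradAxialFlat` ∕ R3′) are the included
  gauged plaquettes of `V♯_y` (`plaqF_axial_pull_eq`), whence ★`dist1_plaq_axial_eq_norm_sub`;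
* §4 ★★★`dist1_axialT_translate_le_of_plaqModulus`: for `U : GaugeField P j SU(N)` with `PlaqSmall a U` (FIRST `RegPr` clause, visible), a centre `y`,
  a no-wrap radius `R` (`2(R + 1) ≤ sitesPerDir j`), `x`, `x + s` in the ball, `|s_κ| ≤ S`, and a bound `p` for the pair modulus of the gauged
  plaquettes of `(U♭)♯_y` in the axial gauge at `0` over the ball for translations `|t_κ| ≤ S` (the OUTPUT SHAPE of R3′ FILE B, which derives it from
  `PlaqSmall ∧ DivSmall` — the SECOND clause enters there):
  `dist1 ((U^{v₀})(y + x + s, μ)·(U^{v₀})(y + x, μ)⁻¹) ≤ d·S·a + d²·R·p`.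
  With the member's letters (`a = ε₀η²`, `R ≤ η⁻¹`, `p ≲ ε₀η²(Sη)^{½}`) this is (★) `≲ ε₀η(Sη)^{½}`; the closed member row (both clauses ⟹ bound,
  no modulus hypothesis) is the next file, on FILE B's olean.

HONEST SCOPE.  Dictionary work; the analytic input (FILE B: the K-uniform curvature ½-Hölder modulus in the axial gauge from `PlaqSmall ∧ DivSmall`)
is a HYPOTHESIS `hmodA` here, stated in FILE B's letters; nothing of GRAD, `hT`, `hGF`, EX, `MinimiserStabilityRegPr` (19200) or the rung
`YM3TorusSU2` is proved; no summit statement is proved; the Yang–Mills mass gap is NOT proved.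
References: [Balaban1985Averaging] (8)–(9) pp. 18–19, (19) p. 21, pp. 24–25; [Balaban1985UV3] (27) p. 263 (the torus axial gauge);
[Balaban1985RegularSpaces] (1.7)–(1.9) p. 77.
-/

set_option autoImplicit false

noncomputable section

open scoped Matrix.Norms.L2Operator
open Literature.MathematicalPhysics.QuantumFieldTheory.Balaban1983to89
open Literature.MathematicalPhysics.QuantumFieldTheory.Balaban1983to89.B7Prop1Explicit (Letter e hol plaqWord gaugeAct axialFn)
open Literature.MathematicalPhysics.QuantumFieldTheory.Balaban1983to89.B7Prop2Explicit (unitaryUnits mem_unitaryUnits)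
open Literature.MathematicalPhysics.QuantumFieldTheory.Balaban1983to89.B10Eq27AxialLog (contour27 hol_contour27)
open Literature.MathematicalPhysics.QuantumFieldTheory.Balaban1983to89.B10Eq27TorusAxialLog (transl transl_apply pull pull_apply gaugeActT
  gaugeActT_eq_gaugeAct holT hol_pull hol_pull_zero hol_pull_plaqWord rel rel_transl_of_mem contourT axialT holT_contourT_eq_gaugeActT unitsField
  toUField suIncl val_suIncl)
open Literature.MathematicalPhysics.QuantumFieldTheory.Balaban1983to89.B8Ineq132 (plaqF)
open Summit.QuantumFields.YangMills.Theorems.Prop7CombTowerCentral (hol_map)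
open Summit.QuantumFields.YangMills.Theorems.AxialGaugeBondModulus (dist1_axial_bond_translate_le)

namespace Summit.QuantumFields.YangMills.Theorems.AxialGaugeTorusTransfer

/-! ## §1 Homomorphisms pass through the complete axial gauge on `ℤ^d` -/

section Hom

variable {d : ℕ} {G H : Type*} [Group G] [Group H]

/-- `f(V^{v₀}) = (f V)^{v₀}`: a homomorphism commutes with the complete axial gauge at `0` (✓`hol_map` inside `axialFn`). [cite: Balaban1985Averaging, (8)-(9) p.19] -/
theorem gaugeAct_axialFn_map (f : G →* H) (V : B7Prop1Explicit.Site d → Fin d → G) (z : B7Prop1Explicit.Site d) (μ : Fin d) :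
    gaugeAct (axialFn (fun x κ => f (V x κ)) 0) (fun x κ => f (V x κ)) z μ = f (gaugeAct (axialFn V 0) V z μ) := by
  simp only [gaugeAct, axialFn, hol_map f V, map_mul, map_inv]

/-- … hence with its holonomies: `(f V)^{v₀}(Γ) = f(V^{v₀}(Γ))`. [cite: Balaban1985Averaging, (9) p.19] -/
theorem hol_gaugeAct_axialFn_map (f : G →* H) (V : B7Prop1Explicit.Site d → Fin d → G) (z : B7Prop1Explicit.Site d) (w : List (Letter d)) :
    hol (gaugeAct (axialFn (fun x κ => f (V x κ)) 0) (fun x κ => f (V x κ))) z w = f (hol (gaugeAct (axialFn V 0) V) z w) := by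
  have h : gaugeAct (axialFn (fun x κ => f (V x κ)) 0) (fun x κ => f (V x κ)) = fun x κ => f (gaugeAct (axialFn V 0) V x κ) :=
    funext fun x => funext fun κ => gaugeAct_axialFn_map f V x κ
  rw [h, hol_map]

end Hom

/-! ## §2 Torus ↔ `ℤ^d`: the torus axial gauge on a no-wrap ball is the pulled-back complete axial gauge -/

section Torus

variable {P : Params} {j : ℕ} {G : Type*}

/-- No wrap-around: a coordinate of size `≤ R` with `2(R + 1) ≤ n` is its own least-absolute-value representative mod `n`. [folklore] -/
theorem two_mul_mem_Ioc {n R : ℕ} {z : ℤ} (hz : |z| ≤ (R : ℤ)) (hR : 2 * (R + 1) ≤ n) : z * 2 ∈ Set.Ioc (-(n : ℤ)) n := by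
  rw [abs_le] at hz
  have hR' : 2 * ((R : ℤ) + 1) ≤ (n : ℤ) := by exact_mod_cast hR
  constructor <;> omega

/-- A point of the box is the relative position of its translate: `rel y (y + z) = z` (no wrap-around). [cite: Balaban1985UV3, (27) p.263] -/
theorem rel_transl_of_box (y : Site P j) {R : ℕ} (hR : 2 * (R + 1) ≤ P.sitesPerDir j) (z : B7Prop1Explicit.Site P.d)
    (hz : ∀ ν, |z ν| ≤ (R : ℤ)) : rel y (transl y z) = z :=
  rel_transl_of_mem y z fun ν => two_mul_mem_Ioc (hz ν) hR

variable [Group G]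

/-- ★ **THE TORUS AXIAL GAUGE IS THE PULLED-BACK COMPLETE AXIAL GAUGE ON THE NO-WRAP BALL**: for `|z_κ| ≤ R`, `2(R + 1) ≤ sitesPerDir`,
`(U^{v₀})(y + z, μ) = ((U♯_y)^{axialFn 0})(z, μ)` with `v₀ = axialT U y` (lit: the contour `Γ_{y,c₋} ∪ c ∪ Γ_{c₊,y}` of (27) read both ways).
[cite: Balaban1985UV3, (27) p.263; Balaban1985Averaging, p.24] -/
theorem gaugeActT_axialT_transl (U : GaugeField P j G) (y : Site P j) {R : ℕ} (hR : 2 * (R + 1) ≤ P.sitesPerDir j)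
    (z : B7Prop1Explicit.Site P.d) (hz : ∀ ν, |z ν| ≤ (R : ℤ)) (μ : Fin P.d) :
    gaugeActT (axialT U y) U ⟨transl y z, μ⟩ = gaugeAct (axialFn (pull U y) 0) (pull U y) z μ := by
  have hrel : rel y (transl y z) = z := rel_transl_of_box y hR z hz
  have hc : (rel y (⟨transl y z, μ⟩ : PBond P j).src (⟨transl y z, μ⟩ : PBond P j).dir + 1) * 2 ≤ (P.sitesPerDir j : ℤ) := by
    show (rel y (transl y z) μ + 1) * 2 ≤ (P.sitesPerDir j : ℤ)
    rw [hrel]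
    have h1 := hz μ; rw [abs_le] at h1
    have hR' : 2 * ((R : ℤ) + 1) ≤ (P.sitesPerDir j : ℤ) := by exact_mod_cast hR
    omega
  rw [← holT_contourT_eq_gaugeActT U y _ hc, contourT, ← hol_pull_zero, hol_contour27]
  show gaugeAct (axialFn (pull U y) 0) (pull U y) (rel y (transl y z)) μ = _
  rw [hrel]

/-- The same for `Setup`'s gauge action `GaugeField.gaugeAct` (`GaugeGroup`-valued configurations). [cite: Balaban1985Averaging, (8) p.19] -/
theorem gaugeAct_axialT_transl {G : Type*} [GaugeGroup G] (U : GaugeField P j G) (y : Site P j) {R : ℕ} (hR : 2 * (R + 1) ≤ P.sitesPerDir j)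
    (z : B7Prop1Explicit.Site P.d) (hz : ∀ ν, |z ν| ≤ (R : ℤ)) (μ : Fin P.d) :
    GaugeField.gaugeAct (axialT U y) U ⟨transl y z, μ⟩ = gaugeAct (axialFn (pull U y) 0) (pull U y) z μ := by
  rw [← gaugeActT_eq_gaugeAct]; exact gaugeActT_axialT_transl U y hR z hz μ

/-- The `PlaqSmall` clause read on the pull-back: every positively oriented `ℤ^d` plaquette of `U♯_y` is within `a` of `1`.
[cite: Balaban1985Variational, (2) p.278] -/
theorem dist1_hol_pull_plaqWord_le {G : Type*} [GaugeGroup G] (U : GaugeField P j G) {a : ℝ} (hU : PlaqSmall a U) (y : Site P j)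
    (z : B7Prop1Explicit.Site P.d) {κ μ : Fin P.d} (h : κ < μ) : dist1 (hol (pull U y) z (plaqWord κ μ)) ≤ a := by
  rw [hol_pull_plaqWord U y z h]; exact (hU _).le

end Torus

/-! ## §3 `SU(N) ↪ M_N(ℂ)ˣ`: `dist1` of unitaries versus operator norms of differences -/

section Unitary

variable {𝔸 : Type*} [NormedRing 𝔸] [StarRing 𝔸] [CStarRing 𝔸]

/-- `‖a·b⁻¹ − 1‖ = ‖a − b‖` for a unit `a` and a unitary unit `b` of a C⋆-algebra (`(a − b)b⁻¹ = ab⁻¹ − 1`, `‖x b⁻¹‖ = ‖x‖`). [folklore] -/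
theorem norm_mul_inv_sub_one_of_unitary (a : 𝔸ˣ) {b : 𝔸ˣ} (hb : b ∈ unitaryUnits 𝔸) :
    ‖(a : 𝔸) * ((b⁻¹ : 𝔸ˣ) : 𝔸) - 1‖ = ‖(a : 𝔸) - b‖ := by
  have hb' : ((b⁻¹ : 𝔸ˣ) : 𝔸) ∈ unitary 𝔸 := mem_unitaryUnits.mp ((unitaryUnits 𝔸).inv_mem hb)
  have e1 : (a : 𝔸) * ((b⁻¹ : 𝔸ˣ) : 𝔸) - 1 = ((a : 𝔸) - b) * ((b⁻¹ : 𝔸ˣ) : 𝔸) := by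
    rw [sub_mul, Units.mul_inv]
  rw [e1, CStarRing.norm_mul_mem_unitary _ hb']

end Unitary

section SpecialUnitary

variable {N : ℕ} [NeZero N]

/-- **`dist1 (X·Y⁻¹) = ‖X − Y‖_op` ON `SU(N)`** (the cell's instance: `dist1 W = ‖W − 1‖_op` through the fundamental representation).
[cite: Balaban1985Averaging, (19) p.21] -/
theorem dist1_mul_inv_eq_norm_sub (X Y : Matrix.specialUnitaryGroup (Fin N) ℂ) :
    dist1 (X * Y⁻¹) = ‖(X : Matrix (Fin N) (Fin N) ℂ) - (Y : Matrix (Fin N) (Fin N) ℂ)‖ := by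
  have h1 : dist1 (X * Y⁻¹) =
      ‖(((Unitary.toUnits.comp suIncl) (X * Y⁻¹) : (Matrix (Fin N) (Fin N) ℂ)ˣ) : Matrix (Fin N) (Fin N) ℂ) - 1‖ := rfl
  have hY : (Unitary.toUnits.comp suIncl) Y ∈ unitaryUnits (Matrix (Fin N) (Fin N) ℂ) := mem_unitaryUnits.mpr (suIncl Y).2
  rw [h1, map_mul, map_inv, Units.val_mul, norm_mul_inv_sub_one_of_unitary _ hY]
  rfl

variable {P : Params} {j : ℕ}

omit [NeZero N] in
/-- The `M_N(ℂ)ˣ`-valued pull-back `(U♭)♯_y` (lit `unitsField ∘ toUField`, the carrier of ✓`CurvGradAxialFlat` ∕ R3′) is the included pull-back.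
[cite: Balaban1985Averaging, (9) p.19] -/
theorem pull_unitsField_toUField (U : GaugeField P j (Matrix.specialUnitaryGroup (Fin N) ℂ)) (y : Site P j) :
    pull (unitsField (toUField U)) y = fun z κ => (Unitary.toUnits.comp suIncl) (pull U y z κ) := rfl

omit [NeZero N] in
/-- The gauged plaquette variables of `(U♭)♯_y` in the axial gauge at `0` are the included gauged plaquette variables of `U♯_y`.
[cite: Balaban1985Averaging, (9) p.19] -/
theorem plaqF_axial_pull_eq (U : GaugeField P j (Matrix.specialUnitaryGroup (Fin N) ℂ)) (y : Site P j) (κ μ : Fin P.d)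
    (z : B7Prop1Explicit.Site P.d) :
    plaqF (gaugeAct (axialFn (pull (unitsField (toUField U)) y) 0) (pull (unitsField (toUField U)) y)) κ μ z =
      ((hol (gaugeAct (axialFn (pull U y) 0) (pull U y)) z (plaqWord κ μ) : Matrix.specialUnitaryGroup (Fin N) ℂ) :
        Matrix (Fin N) (Fin N) ℂ) := by
  show ((hol _ z (plaqWord κ μ) : (Matrix (Fin N) (Fin N) ℂ)ˣ) : Matrix (Fin N) (Fin N) ℂ) = _
  rw [pull_unitsField_toUField, hol_gaugeAct_axialFn_map]
  rfl

/-- ★ **`dist1` OF TRANSLATED GAUGED PLAQUETTES = NORM OF THE `plaqF` DIFFERENCE** in R3′'s letters: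
`dist1 (W(∂p(z′))·W(∂p(z))⁻¹) = ‖plaqF W♭ (z′) − plaqF W♭ (z)‖`, `W = (U♯_y)^{v₀}`, `W♭` its `M_N(ℂ)ˣ` reading. [cite: Balaban1985Averaging, (19) p.21] -/
theorem dist1_plaq_axial_eq_norm_sub (U : GaugeField P j (Matrix.specialUnitaryGroup (Fin N) ℂ)) (y : Site P j) (κ μ : Fin P.d)
    (z z' : B7Prop1Explicit.Site P.d) :
    dist1 (hol (gaugeAct (axialFn (pull U y) 0) (pull U y)) z' (plaqWord κ μ) *
        (hol (gaugeAct (axialFn (pull U y) 0) (pull U y)) z (plaqWord κ μ))⁻¹) =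
      ‖plaqF (gaugeAct (axialFn (pull (unitsField (toUField U)) y) 0) (pull (unitsField (toUField U)) y)) κ μ z' -
        plaqF (gaugeAct (axialFn (pull (unitsField (toUField U)) y) 0) (pull (unitsField (toUField U)) y)) κ μ z‖ := by
  rw [dist1_mul_inv_eq_norm_sub, plaqF_axial_pull_eq, plaqF_axial_pull_eq]

end SpecialUnitary

/-! ## §4 The (★) member row modulo the curvature modulus in the axial gauge -/

section MemberRow

variable {N : ℕ} [NeZero N] {P : Params} {j : ℕ}

/-- ★★★ **THE TORUS TRANSFER — (★) MODULO R3′.**  `U : GaugeField P j SU(N)` with `PlaqSmall a U` (first `RegPr` clause); a centre `y`, a radius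
`R` with no wrap-around `2(R + 1) ≤ sitesPerDir j`; `x`, `x + s` in the ball `{|z_κ| ≤ R}`, `|s_κ| ≤ S`; and `p` bounding, for `z` in the ball,
`|t_κ| ≤ S` and `κ < μ`, the pair modulus `‖plaqF W♭ (z + t) − plaqF W♭ (z)‖` of the gauged plaquettes of the `M_N(ℂ)ˣ` pull-back in the complete
axial gauge at `0` (R3′ FILE B's output; it is where `DivSmall` enters).  Then, with `v₀ = axialT U y` the torus axial gauge,
  `dist1 ((U^{v₀})(y + (x + s), μ)·(U^{v₀})(y + x, μ)⁻¹) ≤ d·S·a + d²·R·p`.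
[cite: Balaban1985Averaging, pp.24-25; Balaban1985UV3, (27) p.263; Balaban1985RegularSpaces, (1.7)-(1.9) p.77] -/
theorem dist1_axialT_translate_le_of_plaqModulus (U : GaugeField P j (Matrix.specialUnitaryGroup (Fin N) ℂ)) {a : ℝ} (ha : 0 ≤ a)
    (hU : PlaqSmall a U) (y : Site P j) (μ : Fin P.d) {R S : ℕ} (hR : 2 * (R + 1) ≤ P.sitesPerDir j) {p : ℝ} (hp : 0 ≤ p)
    (hmodA : ∀ z t : B7Prop1Explicit.Site P.d, (∀ κ, |z κ| ≤ (R : ℤ)) → (∀ κ, |t κ| ≤ (S : ℤ)) → ∀ κ : Fin P.d, κ < μ →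
      ‖plaqF (gaugeAct (axialFn (pull (unitsField (toUField U)) y) 0) (pull (unitsField (toUField U)) y)) κ μ (z + t) -
        plaqF (gaugeAct (axialFn (pull (unitsField (toUField U)) y) 0) (pull (unitsField (toUField U)) y)) κ μ z‖ ≤ p)
    (x s : B7Prop1Explicit.Site P.d) (hx : ∀ κ, |x κ| ≤ (R : ℤ)) (hxs : ∀ κ, |(x + s) κ| ≤ (R : ℤ)) (hS : ∀ κ, |s κ| ≤ (S : ℤ)) :
    dist1 (GaugeField.gaugeAct (axialT U y) U ⟨transl y (x + s), μ⟩ * (GaugeField.gaugeAct (axialT U y) U ⟨transl y x, μ⟩)⁻¹) ≤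
      (P.d : ℝ) * S * a + (P.d : ℝ) ^ 2 * R * p := by
  rw [gaugeAct_axialT_transl U y hR (x + s) hxs μ, gaugeAct_axialT_transl U y hR x hx μ]
  refine dist1_axial_bond_translate_le (pull U y) μ ha hp x s hx hxs hS (fun z _ κ hκ => dist1_hol_pull_plaqWord_le U hU y z hκ)
    (fun z t hz hts κ hκ => ?_)
  rw [dist1_plaq_axial_eq_norm_sub]
  refine hmodA z t hz (fun κ' => ?_) κ hκ
  rcases hts κ' with h | h
  · rw [h]; exact hS κ'
  · rw [h]; simp

end MemberRow

end Summit.QuantumFields.YangMills.Theorems.AxialGaugeTorusTransfer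

end
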